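import Summits.QuantumFields.YangMills.Theorems.UnitScaleTiltProp7ChordalProfile
import Literature.MathematicalPhysics.QuantumFieldTheory.Balaban1983to89.LatticeFieldCalculus
import HarnessLib

/-!
# Route `UnitScaleTilt`, crux K1 «MinimiserStabilityRegPr» (stmt-QuantumFields-19200), route-R E′ path (α′) — the sup-row residue (hK), row (W1) for the assembly (A), part 2 of 2:
# AN ADMISSIBLE AGMON WEIGHT ON THE TORUS — `ω = exp(κ f∕ℓ)` with the two (D2′) rows at `a = 2κ∕ℓ`, `b = 4κ∕ℓ²`, pinched by `exp(c·κ·tdist∕ℓ)`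

Cell `ym3-torus`, D-0154 (3c) twin-width seat `ym-routeR-w2` (gen 5).  THEOREMS ONLY (0 `def`, 0 `sorry`); `--supports stmt-QuantumFields-19200 --as helper`,
count-neutral.  YM₃ on T³ is a ladder rung (R3), not the Clay problem; nothing here claims the stub, the crux, d = 4 or the gap.

THE POINT (ym-routeR-w6 g5 (D2′) ✓ `…AgmonDecay.weighted_laplace_le_core` hypotheses `hω₀ hω₁ hω₂`, and its window ✓∕⧗ `…AgmonWindow`: `a|c|√d·√A ≤ 1∕100`, `b·c²·d·A ≤ 1∕50`
with `A = √C_P·ℓ²` — so `a ≍ κ∕ℓ`, `b ≍ κ∕ℓ²` with an absolute `κ`).  For EVERY base point `b ∈ T^{(j)}`, scale `ℓ ≥ 1` and rate `0 ≤ κ ≤ 1` this file EXHIBITS such a weight: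
positive, with the rows VERBATIM at `a = 2κ∕ℓ`, `b = 4κ∕ℓ²`, and `exp(2κ·tdist(x,b)∕(π√d·ℓ)) ≤ ω(x) ≤ exp(κ(1 + tdist(x,b)∕ℓ))` — so `ω⁻²` is summable at scale ℓ by
✓ `Prop7TorusExpWeightSum.sum_exp_neg_tdist_div_le` and `ω(b) = e^κ ≤ e`.  Construction: `f(x) = √(ℓ² + Σ_μ s_μ(x)²)`, `s_μ(x) = (N∕π)|sin(π·(x_μ − b_μ).val∕N)|` (part 1's letters;
the label of `x ± e_μ` is `t ± 1` up to a period, `exists_val_shift∕unshift`, and the profile is `N`-periodic).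

WHAT IS PROVED (ns `…Theorems.Prop7TorusAgmonWeight`; `Site P j`, `Site.shift∕unshift`, `Site.tdist` of `Setup`).
* §3 `exists_val_eq_add`, `exists_val_shift`, `exists_val_unshift`, `shift_apply_ne'`, `min_val_eq`.
* §4 ★★★ `exists_admissible_weight (b) (hℓ : 1 ≤ ℓ) (hκ0 : 0 ≤ κ) (hκ1 : κ ≤ 1) : ∃ ω, (∀ x, 0 < ω x) ∧ (rows a = 2κ∕ℓ) ∧ (row b = 4κ∕ℓ²) ∧ (lower pinch) ∧ (upper pinch)`.
HONEST SCOPE.  Supplies the displayed `ω` of (D2′); the peeling∕assembly (A) is NOT here.  Constants ours.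

References: T. Bałaban, CMP 96 (1984) 223–250 [Balaban1984PropagatorsII] ((1.9) p.226).
-/

set_option autoImplicit false

noncomputable section

open scoped BigOperators

namespace Summit.QuantumFields.YangMills.Theorems.Prop7TorusAgmonWeight

open Literature.MathematicalPhysics.QuantumFieldTheory.Balaban1983to89
open Finset

/-! ## §3 Torus coordinates: labels of shifted points, and the chordal profile along one direction -/

section Torus

variable {P : Params} {j : ℕ}

/-- integer representatives of a residue differ from its label by a multiple of the modulus. [folklore] -/
theorem exists_val_eq_add {N : ℕ} [NeZero N] (a : ZMod N) (m : ℤ) (h : ((m : ℤ) : ZMod N) = a) :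
    ∃ q : ℤ, ((a.val : ℕ) : ℤ) = m + (N : ℤ) * q := by
  have h' : ((m : ℤ) : ZMod N) = (((a.val : ℕ) : ℤ) : ZMod N) := by rw [h, Int.cast_natCast, ZMod.natCast_zmod_val]
  obtain ⟨q, hq⟩ := (ZMod.intCast_eq_intCast_iff_dvd_sub _ _ _).mp h'
  exact ⟨q, by linarith⟩

/-- the label of `x + e_μ` relative to `b` in direction `μ` is the label of `x` plus one, up to a period. [folklore] -/
theorem exists_val_shift (x b : Site P j) (μ : Fin P.d) :
    ∃ q : ℤ, ((((x.shift μ) μ - b μ).val : ℕ) : ℤ) = (((x μ - b μ).val : ℕ) : ℤ) + 1 + (P.sitesPerDir j : ℤ) * q := by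
  have e : (x.shift μ) μ - b μ = (((((x μ - b μ).val : ℕ) : ℤ) + 1 : ℤ) : ZMod (P.sitesPerDir j)) := by
    push_cast; rw [ZMod.natCast_zmod_val]; simp [Site.shift]; ring
  obtain ⟨q, hq⟩ := exists_val_eq_add _ _ e.symm
  exact ⟨q, by rw [hq]⟩

/-- the label of `x − e_μ` relative to `b` in direction `μ` is the label of `x` minus one, up to a period. [folklore] -/
theorem exists_val_unshift (x b : Site P j) (μ : Fin P.d) :
    ∃ q : ℤ, ((((x.unshift μ) μ - b μ).val : ℕ) : ℤ) = (((x μ - b μ).val : ℕ) : ℤ) - 1 + (P.sitesPerDir j : ℤ) * q := by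
  have e : (x.unshift μ) μ - b μ = (((((x μ - b μ).val : ℕ) : ℤ) - 1 : ℤ) : ZMod (P.sitesPerDir j)) := by
    push_cast; rw [ZMod.natCast_zmod_val]; simp [Site.unshift]; ring
  obtain ⟨q, hq⟩ := exists_val_eq_add _ _ e.symm
  exact ⟨q, by rw [hq]⟩

/-- the other coordinates do not move. [folklore] -/
theorem shift_apply_ne' (x : Site P j) {μ ν : Fin P.d} (h : ν ≠ μ) : (x.shift μ) ν = x ν ∧ (x.unshift μ) ν = x ν := by
  simp [Site.shift, Site.unshift, Function.update_of_ne h]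

/-- the two torus labels of a coordinate difference: `min((x−b).val, (b−x).val) = min(t, N − t)` as reals, `t = (x−b).val`. [folklore] -/
theorem min_val_eq {N : ℕ} [NeZero N] (a : ZMod N) :
    ((min a.val (-a).val : ℕ) : ℝ) = min ((a.val : ℕ) : ℝ) ((N : ℝ) - ((a.val : ℕ) : ℝ)) := by
  rw [ZMod.neg_val]
  split_ifs with h
  · subst h; simp
  · have hlt := ZMod.val_lt a
    rw [Nat.cast_min, Nat.cast_sub hlt.le]

end Torus

/-! ## §4 ★★★ The admissible exponential weight on the torus -/

section Weight

variable {P : Params} {j : ℕ}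

/-- ★★★ **AN ADMISSIBLE AGMON WEIGHT ON `T^{(j)}`** (the `ω` displayed in ✓ `Prop7PinnedBiharmonicAgmonDecay.weighted_laplace_le(_core)`): for every base point `b`, scale
`ℓ ≥ 1` and rate `0 ≤ κ ≤ 1` there is a positive site weight `ω` with the two smoothness rows of (D2′) at `a = 2κ∕ℓ`, `b = 4κ∕ℓ²`, pinched between
`exp(2κ·tdist(x,b)∕(π√d·ℓ))` and `exp(κ(1 + tdist(x,b)∕ℓ))`.  Construction: `ω = exp(κ f∕ℓ)`, `f(x) = √(ℓ² + Σ_μ s_μ(x)²)`, `s_μ(x) = (N∕π)|sin(π·(x_μ−b_μ).val∕N)|` the chordal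
coordinate profile (smooth through the base point AND the antipode; the raw torus distance has an O(1) concave kink at the antipode which would break the `ℓ⁻²` row).
[cite: Balaban1984PropagatorsII, (1.9) p.226] -/
theorem exists_admissible_weight (b : Site P j) {ℓ κ : ℝ} (hℓ : 1 ≤ ℓ) (hκ0 : 0 ≤ κ) (hκ1 : κ ≤ 1) :
    ∃ ω : SiteField P j ℝ, (∀ x, 0 < ω x) ∧
      (∀ x μ, |ω (x.shift μ) - ω x| ≤ (2 * κ / ℓ) * ω x ∧ |ω (x.unshift μ) - ω x| ≤ (2 * κ / ℓ) * ω x) ∧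
      (∀ x μ, |ω (x.shift μ) + ω (x.unshift μ) - 2 * ω x| ≤ (4 * κ / ℓ ^ 2) * ω x) ∧
      (∀ x, Real.exp (2 * κ / (Real.pi * Real.sqrt P.d * ℓ) * (Site.tdist x b : ℝ)) ≤ ω x) ∧
      (∀ x, ω x ≤ Real.exp (κ * (1 + (Site.tdist x b : ℝ) / ℓ))) := by
  classical
  have hπ := Real.pi_pos
  set N : ℕ := P.sitesPerDir j with hN
  have hN0 : (0 : ℝ) < (N : ℝ) := by exact_mod_cast NeZero.pos N
  have hℓ0 : 0 < ℓ := by linarith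
  -- the chordal profile and the smoothed distance
  set ch : ℝ → ℝ := fun τ => (N : ℝ) / Real.pi * |Real.sin (Real.pi * τ / N)| with hch
  have hch0 : ∀ τ, 0 ≤ ch τ := fun τ => by rw [hch]; positivity
  set t : Site P j → Fin P.d → ℝ := fun x μ => (((x μ - b μ).val : ℕ) : ℝ) with ht
  set f : Site P j → ℝ := fun x => Real.sqrt (ℓ ^ 2 + ∑ μ, ch (t x μ) ^ 2) with hf
  have hfℓ : ∀ x, ℓ ≤ f x := fun x => by
    rw [hf]; calc ℓ = Real.sqrt (ℓ ^ 2) := (Real.sqrt_sq hℓ0.le).symm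
      _ ≤ Real.sqrt (ℓ ^ 2 + ∑ μ, ch (t x μ) ^ 2) := Real.sqrt_le_sqrt (by linarith [Finset.sum_nonneg fun μ (_ : μ ∈ Finset.univ) => sq_nonneg (ch (t x μ))])
  -- along direction `μ`: the profile values at `x ± e_μ` are the profile at `t ± 1`
  have hshift : ∀ x μ, ch (t (x.shift μ) μ) = ch (t x μ + 1) ∧ ch (t (x.unshift μ) μ) = ch (t x μ - 1) := by
    intro x μ
    obtain ⟨q₁, hq₁⟩ := exists_val_shift x b μ
    obtain ⟨q₂, hq₂⟩ := exists_val_unshift x b μ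
    have e1 : t (x.shift μ) μ = (t x μ + 1) + (N : ℝ) * q₁ := by simp only [ht]; exact_mod_cast hq₁
    have e2 : t (x.unshift μ) μ = (t x μ - 1) + (N : ℝ) * q₂ := by simp only [ht]; exact_mod_cast hq₂
    exact ⟨by rw [e1]; exact chord_periodic hN0 _ _, by rw [e2]; exact chord_periodic hN0 _ _⟩
  have hother : ∀ x μ ν, ν ≠ μ → t (x.shift μ) ν = t x ν ∧ t (x.unshift μ) ν = t x ν := by
    intro x μ ν h
    obtain ⟨h1, h2⟩ := shift_apply_ne' x (μ := μ) (ν := ν) h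
    refine ⟨?_, ?_⟩ <;> simp only [ht, h1, h2]
  -- splitting off the `μ`-th square
  have hsplit : ∀ (x : Site P j) (μ : Fin P.d), ℓ ^ 2 + ∑ ν, ch (t x ν) ^ 2 = (ℓ ^ 2 + ∑ ν ∈ Finset.univ.erase μ, ch (t x ν) ^ 2) + ch (t x μ) ^ 2 := by
    intro x μ; rw [← Finset.add_sum_erase _ _ (Finset.mem_univ μ)]; ring
  have hB : ∀ (x : Site P j) (μ : Fin P.d), ℓ ^ 2 ≤ ℓ ^ 2 + ∑ ν ∈ Finset.univ.erase μ, ch (t x ν) ^ 2 := fun x μ => by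
    linarith [Finset.sum_nonneg fun ν (_ : ν ∈ Finset.univ.erase μ) => sq_nonneg (ch (t x ν))]
  have hBshift : ∀ (x : Site P j) (μ : Fin P.d), ∑ ν ∈ Finset.univ.erase μ, ch (t (x.shift μ) ν) ^ 2 = ∑ ν ∈ Finset.univ.erase μ, ch (t x ν) ^ 2
      ∧ ∑ ν ∈ Finset.univ.erase μ, ch (t (x.unshift μ) ν) ^ 2 = ∑ ν ∈ Finset.univ.erase μ, ch (t x ν) ^ 2 := by
    intro x μ
    constructor <;> refine Finset.sum_congr rfl fun ν hν => ?_ <;> have h := Finset.ne_of_mem_erase hν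
    · rw [(hother x μ ν h).1]
    · rw [(hother x μ ν h).2]
  -- first and second differences of `f`
  have hdf : ∀ x μ, |f (x.shift μ) - f x| ≤ 1 ∧ |f (x.unshift μ) - f x| ≤ 1 ∧ |f (x.shift μ) + f (x.unshift μ) - 2 * f x| ≤ 2 / ℓ := by
    intro x μ
    set B : ℝ := ℓ ^ 2 + ∑ ν ∈ Finset.univ.erase μ, ch (t x ν) ^ 2 with hBdef
    have hBpos : 0 < B := lt_of_lt_of_le (by positivity) (hB x μ)
    have eF : f x = Real.sqrt (B + ch (t x μ) ^ 2) := by rw [hf]; simp only; rw [hsplit x μ]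
    have eP : f (x.shift μ) = Real.sqrt (B + ch (t x μ + 1) ^ 2) := by
      rw [hf]; simp only; rw [hsplit (x.shift μ) μ, (hBshift x μ).1, (hshift x μ).1]
    have eM : f (x.unshift μ) = Real.sqrt (B + ch (t x μ - 1) ^ 2) := by
      rw [hf]; simp only; rw [hsplit (x.unshift μ) μ, (hBshift x μ).2, (hshift x μ).2]
    have d1 : |ch (t x μ + 1) - ch (t x μ)| ≤ 1 := abs_chord_succ_sub_le hN0 _
    have d2 : |ch (t x μ - 1) - ch (t x μ)| ≤ 1 := by
      have := abs_chord_succ_sub_le hN0 (t x μ - 1)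
      rw [sub_add_cancel] at this; rwa [abs_sub_comm] at this
    have d3 : |ch (t x μ + 1) ^ 2 + ch (t x μ - 1) ^ 2 - 2 * ch (t x μ) ^ 2| ≤ 2 := abs_chord_sq_second_diff_le hN0 _
    rw [eF, eP, eM]
    refine ⟨abs_sqrt_add_sq_sub_le hBpos (hch0 _) (hch0 _) d1, abs_sqrt_add_sq_sub_le hBpos (hch0 _) (hch0 _) d2, ?_⟩
    have h2 := abs_sqrt_add_sq_second_diff_le hBpos (hch0 _) (hch0 _) (hch0 _) d1 d2 d3
    refine h2.trans ?_
    have hsB : ℓ ≤ Real.sqrt B := by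
      calc ℓ = Real.sqrt (ℓ ^ 2) := (Real.sqrt_sq hℓ0.le).symm
        _ ≤ Real.sqrt B := Real.sqrt_le_sqrt (hB x μ)
    exact div_le_div_of_nonneg_left (by norm_num) hℓ0 hsB
  -- the weight
  refine ⟨fun x => Real.exp (κ * f x / ℓ), fun x => Real.exp_pos _, ?_, ?_, ?_, ?_⟩
  · -- first-difference row, `a = 2κ∕ℓ`
    intro x μ
    have hκℓ : κ / ℓ ≤ 1 := by rw [div_le_one hℓ0]; linarith
    have row : ∀ y : ℝ, |y - f x| ≤ 1 → |Real.exp (κ * y / ℓ) - Real.exp (κ * f x / ℓ)| ≤ 2 * κ / ℓ * Real.exp (κ * f x / ℓ) := by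
      intro y hy
      have e : Real.exp (κ * y / ℓ) - Real.exp (κ * f x / ℓ) = Real.exp (κ * f x / ℓ) * (Real.exp (κ * (y - f x) / ℓ) - 1) := by
        rw [mul_sub, mul_one, ← Real.exp_add]; congr 1; ring_nf
      have hz : |κ * (y - f x) / ℓ| ≤ κ / ℓ := by
        rw [abs_div, abs_mul, abs_of_nonneg hκ0, abs_of_pos hℓ0, mul_div_assoc, ← mul_div_assoc]
        calc κ * |y - f x| / ℓ ≤ κ * 1 / ℓ := by gcongr
          _ = κ / ℓ := by ring
      have hz1 : |κ * (y - f x) / ℓ| ≤ 1 := hz.trans hκℓ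
      have h1 := Real.abs_exp_sub_one_le hz1
      rw [e, abs_mul, abs_of_pos (Real.exp_pos _)]
      calc Real.exp (κ * f x / ℓ) * |Real.exp (κ * (y - f x) / ℓ) - 1| ≤ Real.exp (κ * f x / ℓ) * (2 * (κ / ℓ)) :=
            mul_le_mul_of_nonneg_left (h1.trans (by linarith)) (Real.exp_pos _).le
        _ = 2 * κ / ℓ * Real.exp (κ * f x / ℓ) := by ring
    exact ⟨row _ (hdf x μ).1, row _ (hdf x μ).2.1⟩
  · -- second-difference row, `b = 4κ∕ℓ²`
    intro x μ
    obtain ⟨d1, d2, d3⟩ := hdf x μ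
    set p : ℝ := κ * (f (x.shift μ) - f x) / ℓ with hp
    set q : ℝ := κ * (f (x.unshift μ) - f x) / ℓ with hq
    have hκℓ : κ / ℓ ≤ 1 := by rw [div_le_one hℓ0]; linarith
    have habs : ∀ y : ℝ, |y| ≤ 1 → |κ * y / ℓ| ≤ κ / ℓ := fun y hy => by
      rw [abs_div, abs_mul, abs_of_nonneg hκ0, abs_of_pos hℓ0, mul_div_assoc, ← mul_div_assoc]
      calc κ * |y| / ℓ ≤ κ * 1 / ℓ := by gcongr
        _ = κ / ℓ := by ring
    have hp1 : |p| ≤ κ / ℓ := habs _ d1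
    have hq1 : |q| ≤ κ / ℓ := habs _ d2
    have e : Real.exp (κ * f (x.shift μ) / ℓ) + Real.exp (κ * f (x.unshift μ) / ℓ) - 2 * Real.exp (κ * f x / ℓ)
        = Real.exp (κ * f x / ℓ) * ((Real.exp p - 1 - p) + (Real.exp q - 1 - q) + (p + q)) := by
      have ep : Real.exp (κ * f (x.shift μ) / ℓ) = Real.exp (κ * f x / ℓ) * Real.exp p := by rw [← Real.exp_add]; congr 1; rw [hp]; ring
      have eq' : Real.exp (κ * f (x.unshift μ) / ℓ) = Real.exp (κ * f x / ℓ) * Real.exp q := by rw [← Real.exp_add]; congr 1; rw [hq]; ring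
      rw [ep, eq']; ring
    have hpq : |p + q| ≤ κ / ℓ * (2 / ℓ) := by
      have epq : p + q = κ * (f (x.shift μ) + f (x.unshift μ) - 2 * f x) / ℓ := by rw [hp, hq]; ring
      rw [epq, abs_div, abs_mul, abs_of_nonneg hκ0, abs_of_pos hℓ0]
      calc κ * |f (x.shift μ) + f (x.unshift μ) - 2 * f x| / ℓ ≤ κ * (2 / ℓ) / ℓ := by gcongr
        _ = κ / ℓ * (2 / ℓ) := by ring
    have hr1 := Real.abs_exp_sub_one_sub_id_le (hp1.trans hκℓ)
    have hr2 := Real.abs_exp_sub_one_sub_id_le (hq1.trans hκℓ)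
    have hp2 : p ^ 2 ≤ (κ / ℓ) ^ 2 := by rw [← sq_abs]; exact pow_le_pow_left₀ (abs_nonneg _) hp1 2
    have hq2 : q ^ 2 ≤ (κ / ℓ) ^ 2 := by rw [← sq_abs]; exact pow_le_pow_left₀ (abs_nonneg _) hq1 2
    rw [e, abs_mul, abs_of_pos (Real.exp_pos _), mul_comm]
    apply mul_le_mul_of_nonneg_right _ (Real.exp_pos _).le
    have hκ2 : (κ / ℓ) ^ 2 ≤ κ / ℓ ^ 2 := by
      rw [div_pow, div_le_div_iff_of_pos_right (by positivity)]; nlinarith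
    calc |Real.exp p - 1 - p + (Real.exp q - 1 - q) + (p + q)|
        ≤ |Real.exp p - 1 - p| + |Real.exp q - 1 - q| + |p + q| := abs_add_three _ _ _
      _ ≤ p ^ 2 + q ^ 2 + κ / ℓ * (2 / ℓ) := add_le_add (add_le_add hr1 hr2) hpq
      _ ≤ κ / ℓ ^ 2 + κ / ℓ ^ 2 + κ / ℓ * (2 / ℓ) := by linarith
      _ = 4 * κ / ℓ ^ 2 := by ring
  · -- lower comparison with the torus distance
    intro x
    apply Real.exp_le_exp.mpr
    have hd : (1 : ℝ) ≤ P.d := by exact_mod_cast P.hd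
    have hsd : 0 < Real.sqrt P.d := Real.sqrt_pos.mpr (by linarith)
    -- per coordinate: `(2∕π)·min(t, N−t) ≤ ch t`
    have hcoord : ∀ μ, 2 / Real.pi * ((min (x μ - b μ).val (b μ - x μ).val : ℕ) : ℝ) ≤ ch (t x μ) := by
      intro μ
      have e : b μ - x μ = -(x μ - b μ) := by ring
      rw [e, min_val_eq]
      have h0 : 0 ≤ t x μ := by simp only [ht]; positivity
      have h1 : t x μ ≤ N := by simp only [ht]; exact_mod_cast (ZMod.val_lt _).le
      exact (chord_compare hN0 h0 h1).1
    have hsum : 2 / Real.pi * (Site.tdist x b : ℝ) ≤ ∑ μ, ch (t x μ) := by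
      simp only [Site.tdist, Nat.cast_sum, Finset.mul_sum]
      exact Finset.sum_le_sum fun μ _ => hcoord μ
    -- Cauchy–Schwarz: `Σ ch ≤ √d·√(Σ ch²) ≤ √d·f`
    have hcs : ∑ μ, ch (t x μ) ≤ Real.sqrt P.d * f x := by
      have h := Finset.sum_mul_sq_le_sq_mul_sq (Finset.univ : Finset (Fin P.d)) (fun _ => (1 : ℝ)) (fun μ => ch (t x μ))
      simp only [one_pow, one_mul, Finset.sum_const, Finset.card_univ, Fintype.card_fin, nsmul_eq_mul, mul_one] at h
      have h0 : 0 ≤ ∑ μ, ch (t x μ) := Finset.sum_nonneg fun μ _ => hch0 _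
      have hS : ∑ μ, ch (t x μ) ^ 2 ≤ f x ^ 2 := by
        rw [hf]; simp only; rw [Real.sq_sqrt (by positivity)]; nlinarith
      calc ∑ μ, ch (t x μ) = Real.sqrt ((∑ μ, ch (t x μ)) ^ 2) := (Real.sqrt_sq h0).symm
        _ ≤ Real.sqrt ((P.d : ℝ) * f x ^ 2) := Real.sqrt_le_sqrt (h.trans (by nlinarith))
        _ = Real.sqrt P.d * f x := by rw [Real.sqrt_mul (by positivity), Real.sqrt_sq (by linarith [hfℓ x])]
    have key : 2 / Real.pi * (Site.tdist x b : ℝ) ≤ Real.sqrt P.d * f x := hsum.trans hcs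
    calc 2 * κ / (Real.pi * Real.sqrt P.d * ℓ) * (Site.tdist x b : ℝ) = κ / (Real.sqrt P.d * ℓ) * (2 / Real.pi * (Site.tdist x b : ℝ)) := by
          field_simp
      _ ≤ κ / (Real.sqrt P.d * ℓ) * (Real.sqrt P.d * f x) := mul_le_mul_of_nonneg_left key (by positivity)
      _ = κ * f x / ℓ := by field_simp
  · -- upper comparison
    intro x
    apply Real.exp_le_exp.mpr
    have hcoord : ∀ μ, ch (t x μ) ≤ ((min (x μ - b μ).val (b μ - x μ).val : ℕ) : ℝ) := by
      intro μ
      have e : b μ - x μ = -(x μ - b μ) := by ring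
      rw [e, min_val_eq]
      have h0 : 0 ≤ t x μ := by simp only [ht]; positivity
      have h1 : t x μ ≤ N := by simp only [ht]; exact_mod_cast (ZMod.val_lt _).le
      exact (chord_compare hN0 h0 h1).2
    have hsum : ∑ μ, ch (t x μ) ≤ (Site.tdist x b : ℝ) := by
      simp only [Site.tdist, Nat.cast_sum]
      exact Finset.sum_le_sum fun μ _ => hcoord μ
    -- `√(ℓ² + Σ ch²) ≤ ℓ + Σ ch`
    have hS : ∑ μ, ch (t x μ) ^ 2 ≤ (∑ μ, ch (t x μ)) ^ 2 :=
      Finset.sum_sq_le_sq_sum_of_nonneg fun μ _ => hch0 _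
    have h0 : 0 ≤ ∑ μ, ch (t x μ) := Finset.sum_nonneg fun μ _ => hch0 _
    have hfx : f x ≤ ℓ + ∑ μ, ch (t x μ) := by
      rw [hf]; simp only
      rw [Real.sqrt_le_left (by positivity)]
      nlinarith
    calc κ * f x / ℓ ≤ κ * (ℓ + (Site.tdist x b : ℝ)) / ℓ := by gcongr; linarith
      _ = κ * (1 + (Site.tdist x b : ℝ) / ℓ) := by field_simp

end Weight

end Summit.QuantumFields.YangMills.Theorems.Prop7TorusAgmonWeight

end
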